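import Summits.AtomisticToContinuum.Crystallization.Theorems.ChartedZeroExcessLayeredLatticeLiouvilleZZQ
import Summits.AtomisticToContinuum.Crystallization.Theorems.ChartedZeroExcessLayeredLatticeLiouvilleZZE

/-!
# Charted zero-excess layered lattices — Part ZZT: PIN EXTENSION (B′.5, the cone-pin induction assembled)

Route `ChartedPlanarOrder`, station L2′, lineage `stmt-AtomisticToContinuum-26636`.  Imports tree ZZQ (`pin_step`)
and tree ZZE (`pin_induction`; ZZDA `inner_nonpos_of_cone` through it) only.

THE POTENTIAL IS THE DISTANCE TO THE CONTAINER, `d(Ψ x, K) = Metric.infDist (Ψ x) K` (finite nonempty `K`),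
while the CONE stays the `60°`-cone of `Ψ x − x₀` of ZZQ `pin_step` (`K ⊆ B̄(x₀, q)`, `2q ≤ r`).  ★ `dist_lt_dist_of_cone`:
a cone step strictly increases the distance to EVERY container atom (`⟪n − p, k − p⟫ ≤ 0`, ZZDA
`inner_nonpos_of_cone`, so `dist (n, k)² ≥ dist (p, k)² + ‖n − p‖²`); ★ `infDist_lt_infDist_of_cone`: hence
`d(p, K) < d(n, K) ≤ d(p, K) + dist n p` and the step stays in the moat as long as `d(p, K) + dist n p < ℓ`.
(Zoning by `dist (Ψ ·) x₀` — the first draft — does not fit the deep window `W′ = {d(·, K) ∈ (lo, hi)}` of Part ZZR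
for a lopsided container; zoning by `d(·, K)` does, for every admissible `K`.)

★★ `pin_extension`.  SETTING: the S-chart `Ψ, τ` (global), a C-chart `Φ, τ', D`, the partner index map `g` and a
lattice map `Θ` which is an adjacency isomorphism at the sites of `N` (`hiso`) with link-surjectivity there
(`hsurj`) — Part ZZR's clauses 5/6 — and which AGREES with `g` on the KNOWN band `ρ < d(Ψ y, K) ≤ ρ + 43/20` of
the moat `moatIn S K r ℓ` (`hknown`; it lies inside Part ZZR's deep window).  On the SHALLOW zone `d(Ψ x, K) ≤ ρ`
of the moat every site lies in the finite set `T`, its partner atom is two-shell good with charted bonds (LEMMA C),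
and its three-step link neighbourhood lies in `N` (LAYER COVERAGE).  CONCLUSION: `g = Θ` on the whole zone
`d(Ψ ·, K) ≤ ρ + 43/20` of the moat.  PROOF: downward induction on `d(Ψ ·, K)` over `T` (ZZE `pin_induction`); the
step at a shallow `x` is ZZQ `pin_step` with processed set `P = {moat, d ≤ ρ + 43/20, g = Θ}`: a cone point is a
moat site of LARGER potential and potential `≤ ρ + 43/20`, hence processed — by the induction hypothesis if shallow,
by `hknown` if deep.  ★ `pin_extension_record`: `(q, r, ℓ, ρ) = (4, 8, 43/2, 179/16)`, landing bound
`179/16 + 43/20 = 1067/80 (= 13.3375)`.  No new definitions, no new real-side estimate beyond the two cone facts.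
-/

noncomputable section
open scoped RealInnerProductSpace
open Literature.Geometry.DiscreteGeometry (IsTwoShellGoodSet)

namespace Summit.AtomisticToContinuum.Crystallization.Theorems.ChartedZeroExcessLayeredLatticeLiouville

open Summit.AtomisticToContinuum.Crystallization.Theorems.ChartedPlanarOrderRigidityDoor (E3)

/-- ★ **A CONE STEP MOVES AWAY FROM EVERY CONTAINER ATOM.**  `k ∈ B̄(x₀, q)` seen from `p` at distance `≥ r ≥ 2q`;
a step `n − p` in the `60°`-cone of `p − x₀` with `n ≠ p` has `dist p k < dist n k`
(`⟪n − p, k − p⟫ ≤ 0` by ZZDA `inner_nonpos_of_cone`). [this file, g81] -/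
theorem dist_lt_dist_of_cone {p x₀ k n : E3} {q r : ℝ} (hqr : 2 * q ≤ r) (hk : dist k x₀ ≤ q)
    (hkp : r ≤ dist k p) (hcone : 1 / 2 * (‖n - p‖ * ‖p - x₀‖) ≤ ⟪n - p, p - x₀⟫) (hpos : 0 < dist n p) :
    dist p k < dist n k := by
  have hcone' : ⟪n - p, x₀ - p⟫ ≤ -(1 / 2) * (‖n - p‖ * ‖x₀ - p‖) := by
    rw [show x₀ - p = -(p - x₀) by abel, inner_neg_right, norm_neg]; linarith
  have h := inner_nonpos_of_cone hqr hk hkp hcone'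
  have hsq : dist n k ^ 2 = ‖n - p‖ ^ 2 - 2 * ⟪n - p, k - p⟫ + ‖k - p‖ ^ 2 := by
    rw [dist_eq_norm, show n - k = (n - p) - (k - p) by abel, norm_sub_sq_real]
  have hnp : 0 < ‖n - p‖ := by rwa [← dist_eq_norm]
  have hpk : dist p k = ‖k - p‖ := by rw [dist_comm, dist_eq_norm]
  rw [hpk]
  have hlt : ‖k - p‖ ^ 2 < dist n k ^ 2 := by rw [hsq]; nlinarith
  exact lt_of_pow_lt_pow_left₀ 2 dist_nonneg hlt

/-- ★ **THE POTENTIAL `d(·, K)` STRICTLY INCREASES ALONG A CONE STEP** (finite nonempty container), and by at most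
the step length (`Metric.infDist_le_infDist_add_dist`). [this file, g81] -/
theorem infDist_lt_infDist_of_cone {K : Set E3} {p x₀ n : E3} {q r : ℝ} (hKfin : K.Finite) (hKne : K.Nonempty)
    (hqr : 2 * q ≤ r) (hK : ∀ k ∈ K, dist k x₀ ≤ q) (hfar : ∀ k ∈ K, r < dist p k)
    (hcone : 1 / 2 * (‖n - p‖ * ‖p - x₀‖) ≤ ⟪n - p, p - x₀⟫) (hpos : 0 < dist n p) :
    Metric.infDist p K < Metric.infDist n K ∧ Metric.infDist n K ≤ Metric.infDist p K + dist n p := by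
  obtain ⟨k, hk, he⟩ := hKfin.isCompact.exists_infDist_eq_dist hKne n
  refine ⟨?_, Metric.infDist_le_infDist_add_dist⟩
  rw [he]
  have hkp : r ≤ dist k p := by rw [dist_comm]; exact (hfar k hk).le
  exact (Metric.infDist_le_dist_of_mem hk).trans_lt (dist_lt_dist_of_cone hqr (hK k hk) hkp hcone hpos)

/-- ★★ **PIN EXTENSION (symbolic zone dials; potential `d(Ψ ·, K)`).**  See the module docstring.  Binders: ZZQ
`pin_step`'s chart and dial binders verbatim (`hΨ … hhi`), the container (`hKfin hKne hqr hK`) and the closure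
dial (`hℓ : ρ + 43/20 < ℓ`), partners on the landing zone (`hA`), the known band (`hknown`), and on the shallow
zone: membership in `T` (`hT`), LEMMA C's goodness + bond coverage at the partner atom (`hgood`), the three-step
link neighbourhood inside `N` (`hN`); `hiso`, `hsurj` as in `pin_step`. -/
theorem pin_extension {S C K : Set E3} {D N : Set (ℤ × ℤ × ℤ)} {Ψ Φ : ℤ × ℤ × ℤ → E3} {τ τ' : ℤ → Bool}
    {g Θ : ℤ × ℤ × ℤ → ℤ × ℤ × ℤ} {ε δS βS ϑ aLo aHi q r ℓ ρ : ℝ} {x₀ : E3} (T : Finset (ℤ × ℤ × ℤ))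
    (hΨ : IsBarlowBondChart S Set.univ Ψ τ) (hclean : ∀ p ∈ S, IsTwoShellGoodSet (1 / 16) (9 / 10) 1 S p)
    (hsepS : ∀ p ∈ S, ∀ p' ∈ S, p ≠ p' → δS ≤ dist p p') (hε : 2 * ε < δS)
    (hgapS : ∀ p ∈ S, ∀ p' ∈ S, IsBond p p' → dist p p' ≤ βS) (hβS : βS + 2 * ε ≤ 28 / 25)
    (hΦ : IsBarlowBondChart C D Φ τ') (hϑ : 0 ≤ ϑ) (haLo : 0 < aLo) (hbond : aHi * (1 + 2 * ϑ) ≤ 28 / 25)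
    (hlo : aHi * (1 + ϑ) + 2 * ε < 9 / 10 * (Real.sqrt 2 - 1 / 16))
    (hlo' : 28 / 25 + 2 * ε < 9 / 10 * (Real.sqrt 2 - 1 / 16))
    (hhi : 1 * (Real.sqrt 2 + 1 / 16) + 2 * ε ≤ 3 / 2 * aLo)
    (hKfin : K.Finite) (hKne : K.Nonempty) (hqr : 2 * q ≤ r) (hK : ∀ k ∈ K, dist k x₀ ≤ q)
    (hℓ : ρ + 43 / 20 < ℓ)
    (hA : ∀ y, Ψ y ∈ moatIn S K r ℓ → Metric.infDist (Ψ y) K ≤ ρ + 43 / 20 →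
      g y ∈ D ∧ dist (Ψ y) (Φ (g y)) ≤ ε)
    (hknown : ∀ y, Ψ y ∈ moatIn S K r ℓ → ρ < Metric.infDist (Ψ y) K →
      Metric.infDist (Ψ y) K ≤ ρ + 43 / 20 → g y = Θ y)
    (hT : ∀ x, Ψ x ∈ moatIn S K r ℓ → Metric.infDist (Ψ x) K ≤ ρ → x ∈ T)
    (hgood : ∀ x, Ψ x ∈ moatIn S K r ℓ → Metric.infDist (Ψ x) K ≤ ρ →
      IsTwoShellGoodSet ϑ aLo aHi C (Φ (g x)) ∧ ∀ n ∈ C, IsBond (Φ (g x)) n → ∃ y ∈ D, Φ y = n)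
    (hN : ∀ x, Ψ x ∈ moatIn S K r ℓ → Metric.infDist (Ψ x) K ≤ ρ →
      (∀ i, linkPt τ x i ∈ N) ∧ (∀ i j, linkPt τ (linkPt τ x i) j ∈ N) ∧
        ∀ i j k, linkPt τ (linkPt τ (linkPt τ x i) j) k ∈ N)
    (hiso : ∀ y y' : ℤ × ℤ × ℤ, y ∈ N → (BarlowAdj τ y y' ↔ BarlowAdj τ' (Θ y) (Θ y')))
    (hsurj : ∀ y ∈ N, ∀ v : ℤ × ℤ × ℤ, BarlowAdj τ' (Θ y) v → ∃ y', Θ y' = v) :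
    ∀ x, Ψ x ∈ moatIn S K r ℓ → Metric.infDist (Ψ x) K ≤ ρ + 43 / 20 → g x = Θ x := by
  have main : ∀ x ∈ T, Ψ x ∈ moatIn S K r ℓ → Metric.infDist (Ψ x) K ≤ ρ → g x = Θ x := by
    refine pin_induction T (fun y => Metric.infDist (Ψ y) K)
      (Good := fun x => Ψ x ∈ moatIn S K r ℓ → Metric.infDist (Ψ x) K ≤ ρ → g x = Θ x)
      fun x hxT ih hxm hxρ => ?_
    obtain ⟨hxD, hxd⟩ := hA x hxm (by linarith)
    obtain ⟨hg, hcov⟩ := hgood x hxm hxρ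
    obtain ⟨hN1, hN2, hN3⟩ := hN x hxm hxρ
    have hxS : Ψ x ∈ S := hxm.1
    have hfar : ∀ k ∈ K, r < dist (Ψ x) k := hxm.2.2
    have hw : Ψ x ≠ x₀ := by
      intro h
      obtain ⟨k, hk⟩ := hKne
      have h1 := hfar k hk
      have h2 := hK k hk
      rw [h, dist_comm] at h1
      have h3 : (0 : ℝ) ≤ dist k x₀ := dist_nonneg
      linarith
    refine pin_step (P := {y | Ψ y ∈ moatIn S K r ℓ ∧ Metric.infDist (Ψ y) K ≤ ρ + 43 / 20 ∧ g y = Θ y})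
      hΨ hclean hsepS hε hgapS hβS hΦ hxD hxd hg hϑ haLo hbond hcov hlo hlo' hhi
      (fun y hy => ⟨hy.2.2, hA y hy.1 hy.2.1⟩) hiso hsurj hN1 hN2 hN3 hw fun y hc hpos hle => ?_
    have hyS : Ψ y ∈ S := hΨ.2.1 (Set.mem_univ y)
    obtain ⟨hgain, hlip⟩ := infDist_lt_infDist_of_cone hKfin hKne hqr hK hfar hc hpos
    have hland : Metric.infDist (Ψ y) K ≤ ρ + 43 / 20 := by linarith
    have hym : Ψ y ∈ moatIn S K r ℓ := by
      obtain ⟨k, hk, he⟩ := hKfin.isCompact.exists_infDist_eq_dist hKne (Ψ x)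
      refine ⟨hyS, ⟨k, hk, ?_⟩, fun k' hk' => ?_⟩
      · calc dist (Ψ y) k ≤ dist (Ψ y) (Ψ x) + dist (Ψ x) k := dist_triangle _ _ _
          _ ≤ 43 / 20 + ρ := add_le_add hle (he ▸ hxρ)
          _ < ℓ := by linarith
      · have hkp : r ≤ dist k' (Ψ x) := by rw [dist_comm]; exact (hfar k' hk').le
        exact (hfar k' hk').trans (dist_lt_dist_of_cone hqr (hK k' hk') hkp hc hpos)
    refine ⟨hym, hland, ?_⟩
    by_cases hyρ : Metric.infDist (Ψ y) K ≤ ρ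
    · exact ih y (hT y hym hyρ) hgain hym hyρ
    · exact hknown y hym (lt_of_not_ge hyρ) hland
  intro x hxm hx
  by_cases hxρ : Metric.infDist (Ψ x) K ≤ ρ
  · exact main x (hT x hxm hxρ) hxm hxρ
  · exact hknown x hxm (lt_of_not_ge hxρ) hx

/-- ★ **PIN EXTENSION AT THE RECORD ZONE DIALS** `(q, r, ℓ, ρ) = (4, 8, 43/2, 179/16)`: container `K ⊆ B̄(x₀, 4)`
(finite, nonempty), moat `moatIn S K 8 (43/2)`, shallow bound `d(Ψ x, K) ≤ 179/16` (the inner edge of Part ZZR's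
deep window), landing bound `179/16 + 43/20 = 1067/80`; the known band `179/16 < d ≤ 1067/80` lies inside the deep
window `(179/16, 293/16)`.  The chart / dial binders are `pin_step`'s verbatim. -/
theorem pin_extension_record {S C K : Set E3} {D N : Set (ℤ × ℤ × ℤ)} {Ψ Φ : ℤ × ℤ × ℤ → E3}
    {τ τ' : ℤ → Bool} {g Θ : ℤ × ℤ × ℤ → ℤ × ℤ × ℤ} {ε δS βS ϑ aLo aHi : ℝ} {x₀ : E3}
    (T : Finset (ℤ × ℤ × ℤ))
    (hΨ : IsBarlowBondChart S Set.univ Ψ τ) (hclean : ∀ p ∈ S, IsTwoShellGoodSet (1 / 16) (9 / 10) 1 S p)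
    (hsepS : ∀ p ∈ S, ∀ p' ∈ S, p ≠ p' → δS ≤ dist p p') (hε : 2 * ε < δS)
    (hgapS : ∀ p ∈ S, ∀ p' ∈ S, IsBond p p' → dist p p' ≤ βS) (hβS : βS + 2 * ε ≤ 28 / 25)
    (hΦ : IsBarlowBondChart C D Φ τ') (hϑ : 0 ≤ ϑ) (haLo : 0 < aLo) (hbond : aHi * (1 + 2 * ϑ) ≤ 28 / 25)
    (hlo : aHi * (1 + ϑ) + 2 * ε < 9 / 10 * (Real.sqrt 2 - 1 / 16))
    (hlo' : 28 / 25 + 2 * ε < 9 / 10 * (Real.sqrt 2 - 1 / 16))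
    (hhi : 1 * (Real.sqrt 2 + 1 / 16) + 2 * ε ≤ 3 / 2 * aLo)
    (hKfin : K.Finite) (hKne : K.Nonempty) (hK : ∀ k ∈ K, dist k x₀ ≤ 4)
    (hA : ∀ y, Ψ y ∈ moatIn S K 8 (43 / 2) → Metric.infDist (Ψ y) K ≤ 1067 / 80 →
      g y ∈ D ∧ dist (Ψ y) (Φ (g y)) ≤ ε)
    (hknown : ∀ y, Ψ y ∈ moatIn S K 8 (43 / 2) → 179 / 16 < Metric.infDist (Ψ y) K →
      Metric.infDist (Ψ y) K ≤ 1067 / 80 → g y = Θ y)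
    (hT : ∀ x, Ψ x ∈ moatIn S K 8 (43 / 2) → Metric.infDist (Ψ x) K ≤ 179 / 16 → x ∈ T)
    (hgood : ∀ x, Ψ x ∈ moatIn S K 8 (43 / 2) → Metric.infDist (Ψ x) K ≤ 179 / 16 →
      IsTwoShellGoodSet ϑ aLo aHi C (Φ (g x)) ∧ ∀ n ∈ C, IsBond (Φ (g x)) n → ∃ y ∈ D, Φ y = n)
    (hN : ∀ x, Ψ x ∈ moatIn S K 8 (43 / 2) → Metric.infDist (Ψ x) K ≤ 179 / 16 →
      (∀ i, linkPt τ x i ∈ N) ∧ (∀ i j, linkPt τ (linkPt τ x i) j ∈ N) ∧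
        ∀ i j k, linkPt τ (linkPt τ (linkPt τ x i) j) k ∈ N)
    (hiso : ∀ y y' : ℤ × ℤ × ℤ, y ∈ N → (BarlowAdj τ y y' ↔ BarlowAdj τ' (Θ y) (Θ y')))
    (hsurj : ∀ y ∈ N, ∀ v : ℤ × ℤ × ℤ, BarlowAdj τ' (Θ y) v → ∃ y', Θ y' = v) :
    ∀ x, Ψ x ∈ moatIn S K 8 (43 / 2) → Metric.infDist (Ψ x) K ≤ 1067 / 80 → g x = Θ x := by
  have h := pin_extension (q := 4) (r := 8) (ℓ := 43 / 2) (ρ := 179 / 16) T hΨ hclean hsepS hε hgapS hβS hΦ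
    hϑ haLo hbond hlo hlo' hhi hKfin hKne (by norm_num) hK (by norm_num)
    (fun y hy hd => hA y hy (by norm_num at hd ⊢; exact hd))
    (fun y hy h1 h2 => hknown y hy h1 (by norm_num at h2 ⊢; exact h2)) hT hgood hN hiso hsurj
  intro x hxm hx
  exact h x hxm (by norm_num; exact hx)

end Summit.AtomisticToContinuum.Crystallization.Theorems.ChartedZeroExcessLayeredLatticeLiouville

end
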